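import Summits.NavierStokesRegularity.FluidComputer.LerayClock
import Literature.Analysis.FluidPDE.MillerMiddleEigenvalueCriterionProofs
import Literature.Analysis.FluidPDE.CheskidovShvydkoyAssembly
import Literature.Analysis.FluidPDE.AncientLPSLiouvilleProofs
import HarnessLib

/-!
# Fluid computer — the level dictionary, STRAIN FACE (L41): the middle eigenvalue of the strain has divergent
# Prodi–Serrin integrals (Neustupa–Penel / Miller)

HONEST FRAMING (cell `pub-fluidc`, verbatim): *low prior, high value-of-information experiment on Tao's
machine paradigm; NOT a claim that NS blows up.* Theorem side of the cell; nothing here is evidence of blow-up.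
The Serrin face L30 constrains the SIZE of `u`, the BKM face L31 the size of `ω`, the Constantin–Fefferman face
L32 the DIRECTION of `ω`. The strain `S = ½(∇u + ∇uᵀ)` has eigenvalues `λ₁ ≤ λ₂ ≤ λ₃`, `λ₁ + λ₂ + λ₃ = 0`; the
enstrophy grows only through `−4∫det S = −4∫λ₁λ₂λ₃ ≤ 2∫|S|²λ₂⁺`, so only regions with TWO positive principal
strains (sheet-forming strain, `λ₂ > 0`) produce enstrophy. Neustupa–Penel (2001) and Miller (Arch. Ration. Mech.
Anal. 237 (2020), Thm. 1.1) turned this into a regularity criterion: `λ₂⁺ ∈ L^p_t L^q_x`, `2/p + 3/q = 2`,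
`3/2 < q ≤ ∞`, implies regularity. The tree PROVES Miller's Gronwall bound on Tao's `H¹` patches
(`limsup_eH1NormSq_lt_top_of_midStrain`) and Leray's `H¹` continuation (`leray_continuation_H1_holds`); read
against the enstrophy clock L19 (`LerayClock.enstrophy_clock_toReal`) they give, for every maximal smooth solution
`(u, p)` of the unforced Navier–Stokes system on `ℝ³ × [0, T)` (`ν > 0`) which is Leray–Hopf from `u 0`, and every
nonnegative MAJORANT `m` of the middle eigenvalue in Courant–Fischer form (at each `(t, x)` an orthonormal pair
`v, w` with `⟪∇u(t,x)ξ, ξ⟫ ≤ m(t, x)|ξ|²` for all `ξ ∈ span{v, w}` — e.g. `m = λ₂⁺` itself, with `v, w` the two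
lower eigenvectors):

* `strain_lintegral_eq_top` (**L41 — THE MIDDLE-EIGENVALUE INTEGRALS DIVERGE**): for every `3/2 < q < ∞`,
  `∫₀ᵀ (∫ m(t, x)^q dx)^{2/(2q−3)} dt = ∞` — i.e. `‖λ₂⁺‖_{L^p_t L^q_x(0,T)} = ∞` with `2/p + 3/q = 2`;
* `strain_lintegral_window_eq_top` (**L41′ — ON EVERY TERMINAL WINDOW**): `∫_{t₀}^T (∫ m^q)^{2/(2q−3)} = ∞` for
  every `t₀ < T` (restart at an a.e.-good time);
* `strain_face`: both assembled.

Reading for the machine paradigm (words): a blow-up needs SHEET-FORMING strain (two stretching directions) of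
non-integrable intensity in every terminal window, at the Prodi–Serrin rate `‖λ₂⁺(t)‖_{L^q} ≳ (T − t)^{−(2q−3)/(2q)}`
in the mean; a machine whose intense strain stays TUBE-FORMING (one stretching direction, `λ₂ ≤ 0`) wherever it is
strong — the axial strain of a straining vortex tube — does not blow up. Constants inexplicit; the endpoint
`q = ∞` (`∫‖λ₂⁺‖_∞ dt = ∞`) is in Miller's theorem but not in the tree's discharge, hence not here. Necessity only.
0 sorry; no new definitions, no named facts.

## References

* E. Miller, *A regularity criterion for the Navier–Stokes equation involving only the middle eigenvalue of the
  strain tensor*, Arch. Ration. Mech. Anal. 237 (2020) 1237–1263 (arXiv:1710.05569), Thm. 1.1, Lemma 5.1.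
  [Miller2019]
* J. Neustupa, P. Penel, in *Mathematical Fluid Mechanics*, Birkhäuser 2001, 237–265, Thm. 2. [NeustupaPenel2001]
* J. C. Robinson, J. L. Rodrigo, W. Sadowski, CUP 2016, Lemma 6.11, Lemma 8.16. [RobinsonRodrigoSadowski2016]
-/

noncomputable section

open MeasureTheory Set Function Filter Topology Metric InnerProductSpace
open scoped ENNReal NNReal RealInnerProductSpace
open Literature.Analysis.FluidPDE Literature.Analysis.FunctionSpaces
open Literature.Analysis.FluidPDE.LPBounds (gradSq)
open Summit.NavierStokesRegularity.FluidComputer.LerayClock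
open Summit.NavierStokesRegularity.FluidComputer.BlockEnergyTransport

namespace Summit.NavierStokesRegularity.FluidComputer.StrainFace

/-! ## L41: the middle-eigenvalue integrals diverge -/

/-- **L41 — THE PRODI–SERRIN INTEGRALS OF THE MIDDLE STRAIN EIGENVALUE DIVERGE.** For `ν > 0`, `T > 0`, every
maximal smooth solution `(u, p)` of the unforced Navier–Stokes system on `ℝ³ × [0, T)` which is Leray–Hopf from
`u 0`, every `3/2 < q` and every nonnegative Courant–Fischer majorant `m` of the middle eigenvalue of the strain on
`[0, T) × ℝ³`: `∫_{(0,T)} (∫ m(t, x)^q dx)^{2/(2q−3)} dt = ∞`. Proof: were it finite, Miller's bound on Tao's `H¹`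
patches (`limsup_eH1NormSq_lt_top_of_midStrain`, PROVED in the tree) and Leray's `H¹` continuation
(`leray_continuation_H1_holds`) would make `u` `H¹`-regular on `(0, T]`, so `‖u(t)‖²_{H¹} ≤ A < ∞` on `[T/2, T]`;
but the enstrophy clock L19 demands `c₁ν³ ≤ Z(t)²(T − t)` with `Z(t) = ∫|∇u(t)|² ≤ A` — impossible as `t ↑ T`.
[cite: Miller2019, Thm 1.1 (proof of Thm 5.2)] [cite: NeustupaPenel2001, Thm 2]
[cite: RobinsonRodrigoSadowski2016, Lemma 6.11 and Lemma 8.16] -/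
theorem strain_lintegral_eq_top {ν T : ℝ} (hν : 0 < ν) (hT : 0 < T)
    {u : ℝ → EuclideanSpace ℝ (Fin 3) → EuclideanSpace ℝ (Fin 3)} {p : ℝ → EuclideanSpace ℝ (Fin 3) → ℝ}
    (hmax : IsMaximalSmoothSolution ν 0 u p T) (hLH : IsLerayHopfOn T ν 0 (u 0) u)
    {q : ℝ} (hq : 3 / 2 < q) {m : ℝ → EuclideanSpace ℝ (Fin 3) → ℝ} (hm0 : ∀ t x, 0 ≤ m t x)
    (hmaj : ∀ t ∈ Ico 0 T, ∀ x, ∃ v w : EuclideanSpace ℝ (Fin 3), ‖v‖ = 1 ∧ ‖w‖ = 1 ∧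
      inner ℝ v w = 0 ∧ ∀ α β : ℝ,
        inner ℝ (fderiv ℝ (u t) x (α • v + β • w)) (α • v + β • w) ≤ m t x * (α ^ 2 + β ^ 2)) :
    ∫⁻ t in Ioo 0 T, (∫⁻ x, ENNReal.ofReal (m t x) ^ q) ^ (2 / (2 * q - 3)) = ⊤ := by
  by_contra hfin
  obtain ⟨c, hc, hL2⟩ := tao2011_H1_local_almost_regular_holds
  -- `u` is `H¹`-regular on `(0, T]`
  have hregT : IsH1RegularOn (Ioc 0 T) u :=
    leray_continuation_H1_holds ν T hν hT (u 0) u hLH fun α β hα hαβ hβ hregI =>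
      limsup_eH1NormSq_lt_top_of_midStrain hL2 hc hν hLH hmax.1 hq hm0 hmaj hfin hα hαβ hβ hregI
  have hreg : IsH1RegularOn (Icc (T / 2) T) u := hregT.mono fun t ht => ⟨by linarith [ht.1], ht.2⟩
  obtain ⟨A, hAtop, hAle⟩ := hreg.exists_forall_le isCompact_Icc subset_rfl
  -- the enstrophy clock
  obtain ⟨c₁, hc₁, H⟩ := enstrophy_clock_toReal
  set a : ℝ := A.toReal with ha
  have ha0 : 0 ≤ a := ENNReal.toReal_nonneg
  have hcν : 0 < c₁ * ν ^ 3 := mul_pos hc₁ (pow_pos hν 3)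
  have ha1 : 0 < a ^ 2 + 1 := by positivity
  -- a time close to `T`
  set t : ℝ := max (T / 2) (T - c₁ * ν ^ 3 / (2 * (a ^ 2 + 1))) with htdef
  have hδ : 0 < c₁ * ν ^ 3 / (2 * (a ^ 2 + 1)) := by positivity
  have ht2 : T / 2 ≤ t := le_max_left _ _
  have htT : t < T := max_lt (by linarith) (by linarith)
  have ht0 : 0 < t := by linarith
  have hTt : T - t ≤ c₁ * ν ^ 3 / (2 * (a ^ 2 + 1)) := by
    have := le_max_right (T / 2) (T - c₁ * ν ^ 3 / (2 * (a ^ 2 + 1)))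
    linarith
  have hclock := H ν T hν hT u p hmax hLH t ⟨ht0, htT⟩
  -- the enstrophy at `t` is below `a`
  obtain ⟨hZ, hZtop⟩ := lintegral_frobeniusNormSq_eq_gradSq hν hT hmax hLH ⟨ht0, htT⟩
  have hsm : IsSmoothL2Field (u t) := isSmoothL2Field_slice_of_maximal hν hT hmax hLH ⟨ht0, htT⟩
  have hZle : (∫⁻ x, ENNReal.ofReal (frobeniusNormSq (fderiv ℝ (u t) x))).toReal ≤ a := by
    rw [hZ, gradSq_eq_eWeakGradL2Sq hsm, ha]
    refine ENNReal.toReal_mono hAtop.ne ?_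
    calc eWeakGradL2Sq (u t) ≤ eH1NormSq (u t) := le_add_self
      _ ≤ A := hAle t ⟨ht2, htT.le⟩
  have hZnn : 0 ≤ (∫⁻ x, ENNReal.ofReal (frobeniusNormSq (fderiv ℝ (u t) x))).toReal := ENNReal.toReal_nonneg
  -- contradiction: `c₁ν³ ≤ Z² (T − t) ≤ a² · c₁ν³ / (2(a²+1)) < c₁ν³`
  have h1 : (∫⁻ x, ENNReal.ofReal (frobeniusNormSq (fderiv ℝ (u t) x))).toReal ^ 2 * (T - t) ≤
      a ^ 2 * (c₁ * ν ^ 3 / (2 * (a ^ 2 + 1))) :=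
    mul_le_mul (pow_le_pow_left₀ hZnn hZle 2) hTt (by linarith) (sq_nonneg a)
  have h2 : a ^ 2 * (c₁ * ν ^ 3 / (2 * (a ^ 2 + 1))) < c₁ * ν ^ 3 := by
    rw [← mul_div_assoc, div_lt_iff₀ (by positivity)]
    nlinarith [sq_nonneg a]
  linarith

/-- **L41′ — ON EVERY TERMINAL WINDOW.** With the same data, for every `t₀ ∈ [0, T)`:
`∫_{(t₀,T)} (∫ m(t, x)^q dx)^{2/(2q−3)} dt = ∞`. Proof: restart at an a.e.-good time `s ∈ (t₀, T)`; the translate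
`u(· + s)` is a maximal smooth solution with lifespan `T − s` (`IsMaximalSmoothSolution.translate`), Leray–Hopf from
`u s`, with the majorant `m(· + s)`; apply L41 and translate the time integral back.
[cite: Miller2019, Thm 1.1] [cite: NeustupaPenel2001, Thm 2] -/
theorem strain_lintegral_window_eq_top {ν T : ℝ} (hν : 0 < ν)
    {u : ℝ → EuclideanSpace ℝ (Fin 3) → EuclideanSpace ℝ (Fin 3)} {p : ℝ → EuclideanSpace ℝ (Fin 3) → ℝ}
    (hmax : IsMaximalSmoothSolution ν 0 u p T) (hLH : IsLerayHopfOn T ν 0 (u 0) u)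
    {q : ℝ} (hq : 3 / 2 < q) {m : ℝ → EuclideanSpace ℝ (Fin 3) → ℝ} (hm0 : ∀ t x, 0 ≤ m t x)
    (hmaj : ∀ t ∈ Ico 0 T, ∀ x, ∃ v w : EuclideanSpace ℝ (Fin 3), ‖v‖ = 1 ∧ ‖w‖ = 1 ∧
      inner ℝ v w = 0 ∧ ∀ α β : ℝ,
        inner ℝ (fderiv ℝ (u t) x (α • v + β • w)) (α • v + β • w) ≤ m t x * (α ^ 2 + β ^ 2))
    {t₀ : ℝ} (ht₀ : t₀ ∈ Ico 0 T) :
    ∫⁻ t in Ioo t₀ T, (∫⁻ x, ENNReal.ofReal (m t x) ^ q) ^ (2 / (2 * q - 3)) = ⊤ := by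
  -- an a.e.-good restart time `s ∈ (t₀, T)`
  obtain ⟨s, hs, hLHs⟩ := hLH.exists_isLerayHopfOn_restart_Ioo hν.le ht₀.1 ht₀.2 le_rfl
  have hs0 : 0 < s := ht₀.1.trans_lt hs.1
  have hTs : 0 < T - s := sub_pos.2 hs.2
  have hmax' : IsMaximalSmoothSolution ν 0 (fun t => u (t + s)) (fun t => p (t + s)) (T - s) :=
    hmax.translate_zero hs0 hs.2
  have hLH' : IsLerayHopfOn (T - s) ν 0 ((fun t => u (t + s)) 0) (fun t => u (t + s)) := by
    show IsLerayHopfOn (T - s) ν 0 (u (0 + s)) (fun t => u (t + s))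
    rw [zero_add]
    exact hLHs
  have hmaj' : ∀ t ∈ Ico 0 (T - s), ∀ x, ∃ v w : EuclideanSpace ℝ (Fin 3), ‖v‖ = 1 ∧ ‖w‖ = 1 ∧
      inner ℝ v w = 0 ∧ ∀ α β : ℝ,
        inner ℝ (fderiv ℝ ((fun t => u (t + s)) t) x (α • v + β • w)) (α • v + β • w) ≤
          m (t + s) x * (α ^ 2 + β ^ 2) :=
    fun t ht x => hmaj (t + s) ⟨by linarith [ht.1, hs0], by linarith [ht.2]⟩ x
  have key := strain_lintegral_eq_top hν hTs hmax' hLH' hq (m := fun t => m (t + s)) (fun t x => hm0 _ _) hmaj'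
  -- translate the time integral back: `∫_{(0,T−s)} F(t+s) dt = ∫_{(s,T)} F ≤ ∫_{(t₀,T)} F`
  set F : ℝ → ℝ≥0∞ := fun t => (∫⁻ x, ENNReal.ofReal (m t x) ^ q) ^ (2 / (2 * q - 3)) with hF
  have hshift : ∫⁻ t in Ioo 0 (T - s), F (t + s) = ∫⁻ t in Ioo s T, F t := by
    rw [lintegral_Ioo_comp_add_right F s (T - s), add_sub_cancel]
  have hmono : ∫⁻ t in Ioo s T, F t ≤ ∫⁻ t in Ioo t₀ T, F t :=
    lintegral_mono_set (Ioo_subset_Ioo_left hs.1.le)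
  have hkey' : ∫⁻ t in Ioo 0 (T - s), F (t + s) = ⊤ := key
  rw [hshift] at hkey'
  exact eq_top_iff.2 (hkey' ▸ hmono)

/-- **THE STRAIN FACE, ASSEMBLED**: on every terminal window the Prodi–Serrin integral
`∫ (∫ m^q)^{2/(2q−3)}` of every nonnegative Courant–Fischer majorant `m` of the middle strain eigenvalue diverges,
for every `3/2 < q`. [cite: Miller2019, Thm 1.1] [cite: NeustupaPenel2001, Thm 2] -/
theorem strain_face {ν T : ℝ} (hν : 0 < ν)
    {u : ℝ → EuclideanSpace ℝ (Fin 3) → EuclideanSpace ℝ (Fin 3)} {p : ℝ → EuclideanSpace ℝ (Fin 3) → ℝ}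
    (hmax : IsMaximalSmoothSolution ν 0 u p T) (hLH : IsLerayHopfOn T ν 0 (u 0) u) :
    ∀ q : ℝ, 3 / 2 < q → ∀ m : ℝ → EuclideanSpace ℝ (Fin 3) → ℝ, (∀ t x, 0 ≤ m t x) →
      (∀ t ∈ Ico 0 T, ∀ x, ∃ v w : EuclideanSpace ℝ (Fin 3), ‖v‖ = 1 ∧ ‖w‖ = 1 ∧
        inner ℝ v w = 0 ∧ ∀ α β : ℝ,
          inner ℝ (fderiv ℝ (u t) x (α • v + β • w)) (α • v + β • w) ≤ m t x * (α ^ 2 + β ^ 2)) →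
      ∀ t₀ ∈ Ico 0 T, ∫⁻ t in Ioo t₀ T, (∫⁻ x, ENNReal.ofReal (m t x) ^ q) ^ (2 / (2 * q - 3)) = ⊤ :=
  fun _ hq _ hm0 hmaj _ ht₀ => strain_lintegral_window_eq_top hν hmax hLH hq hm0 hmaj ht₀

end Summit.NavierStokesRegularity.FluidComputer.StrainFace

end
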